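import Summits.ResolutionOfSingularities.ResolutionOfSingularities.Theorems.FrobeniusLadderFRationalResolutionFixedStratumVertexSingular
import Summits.ResolutionOfSingularities.ResolutionOfSingularities.Theorems.FrobeniusLadderFRationalResolutionFixedStratumNearby
import HarnessLib

/-!
# Crux `FrobeniusLadder.FRationalResolution` (stmt-ResolutionOfSingularities-15317), line `redirect`,
# stub `stub_diagonalizableQuotientResolution` — **`V(J) ⊆ Sing` on a whole neighbourhood: every prime of the vertex
# chart algebra containing `χ(Q ∖ ℤF_𝔭)` — over ANY point of the stratum, comparable with `𝔭` or not — is singular**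
# (design C3 = the rank-2 stratum layer of the non-isolated case, memo MEMO-15317-leafhand2-g10 §2 (L3-a/b): the
# direction «centre ⊆ singular locus» of the hypothesis `hZ` of `…FixedStratumAffineCentre.singularLocusIdeal_Spec_eq_idealSheaf`,
# assembled from `…FixedStratumVertexSingular` (base point comparable) and `…FixedStratumNearby.face_zero_package`
# (re-basing at an incomparable stratum point of a sharp base chart))

* **`not_isRegularLocalRing_of_forall_chi_mem`** — sharp base chart `φ : P → A` (unit face `0` at `𝔭`, rank bound
  `n − rk ≤ 2`) log regular at every prime `𝔮 ⊇ I(𝔭, φ)` of the basic open `D(g) ∋ 𝔭`; vertex chart algebra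
  `(C, Q, χ)` with `c ≥ 2`; then for every prime `𝔔` of `C` with `g ∉ 𝔔`, `I(𝔭) ⊆ 𝔔 ∩ A` and `χ(Q ∖ ℤF_𝔭) ⊆ 𝔔`:
  `C_𝔔` is not regular.

Honest label: assembly toward ONE leaf stub (no stub, crux or summit closed). No definitions, no named facts, no
sorry. [cite: Kato1994, (6.1), (7.3), (10.1)] [cite: Matsumura1987, Thm. 19.3]
-/

noncomputable section

-- single-problem summit: the doubled namespace component is forced
set_option linter.dupNamespace false

open IsLocalRing Literature.AlgebraicGeometry.Resolution Literature.AlgebraicGeometry.Resolution.LogChart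
open Summit.ResolutionOfSingularities.ResolutionOfSingularities.Theorems.FRationalResolution.FixedStratumVertexSingular
open Summit.ResolutionOfSingularities.ResolutionOfSingularities.Theorems.FRationalResolution.FixedStratumNearby

namespace Summit.ResolutionOfSingularities.ResolutionOfSingularities.Theorems.FRationalResolution.FixedStratumVertexSingularNearby

universe u

variable {A : Type u} [CommRing A] [IsNoetherianRing A] {n : ℕ} {P : AddSubmonoid (Fin n → ℤ)}
  {φ : Multiplicative P →* A} {𝔭 : Ideal A} [𝔭.IsPrime] {C : Type u} [CommRing C] [Algebra A C]
  {Q : AddSubmonoid (Fin n → ℤ)} {χ : Multiplicative Q →* C} {v x : Fin n → ℤ} {c : ℕ}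

/-- **Every prime of the vertex chart algebra containing `χ(Q ∖ ℤF_𝔭)`, over the log regular neighbourhood `D(g)` of
`𝔭`, is singular.** See the module docstring. [cite: Kato1994, (6.1), (7.3), (10.1)] [cite: Matsumura1987, Thm. 19.3] -/
theorem not_isRegularLocalRing_of_forall_chi_mem [IsNoetherianRing C] (hc : 2 ≤ c) (hP : P.FG)
    (hsat : ∀ (w : Fin n → ℤ) (k : ℕ), 0 < k → k • w ∈ P → w ∈ P)
    (hface : ∀ p : P, (p : Fin n → ℤ) ≠ 0 → φ (Multiplicative.ofAdd p) ∈ 𝔭)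
    (hrank : n - Module.finrank ℤ (Submodule.span ℤ (faceMonoid P φ 𝔭 : Set (Fin n → ℤ))) ≤ 2)
    (g : A) (hregV : ∀ (𝔮 : Ideal A) [𝔮.IsPrime], ideal P φ 𝔭 ≤ 𝔮 → g ∉ 𝔮 → IsLogRegularAt P φ 𝔮)
    (hPQ : P ≤ Q)
    (hχ : ∀ p : P, χ (Multiplicative.ofAdd ⟨(p : Fin n → ℤ), hPQ p.2⟩) =
      algebraMap A C (φ (Multiplicative.ofAdd p)))
    (hgen : Algebra.adjoin A (Set.range χ) = ⊤)
    (hD : ∀ q ∈ Q, ∃ p ∈ P, q + p ∈ P)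
    (hK : ∀ a : A, algebraMap A C a = 0 → ∃ p : P, φ (Multiplicative.ofAdd p) * a = 0)
    (hQfg : Q.FG)
    (hQ : ∀ w, w ∈ Q ↔ ∃ g ∈ Submodule.span ℤ (faceMonoid P φ 𝔭 : Set (Fin n → ℤ)), ∃ m l : ℤ,
      0 ≤ m ∧ 0 ≤ m + (c : ℤ) * l ∧ w = g + m • v + l • x)
    (hind : ∀ g ∈ Submodule.span ℤ (faceMonoid P φ 𝔭 : Set (Fin n → ℤ)), ∀ m l : ℤ,
      g + m • v + l • x = 0 → m = 0 ∧ l = 0)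
    (hspan : ∀ w : Fin n → ℤ, ∃ g ∈ Submodule.span ℤ (faceMonoid P φ 𝔭 : Set (Fin n → ℤ)),
      ∃ m l : ℤ, w = g + m • v + l • x)
    {𝔔 : Ideal C} [𝔔.IsPrime] (hg𝔔 : algebraMap A C g ∉ 𝔔)
    (hI𝔔 : ideal P φ 𝔭 ≤ 𝔔.comap (algebraMap A C))
    (hq𝔔 : ∀ q : Q, (q : Fin n → ℤ) ∉ Submodule.span ℤ (faceMonoid P φ 𝔭 : Set (Fin n → ℤ)) →
      χ (Multiplicative.ofAdd q) ∈ 𝔔) :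
    ¬ IsRegularLocalRing (Localization.AtPrime 𝔔) := by
  -- the base point under `𝔔`: a point of the stratum, possibly incomparable with `𝔭`
  set 𝔮 : Ideal A := 𝔔.comap (algebraMap A C) with h𝔮def
  haveI : 𝔮.IsPrime := Ideal.IsPrime.comap _
  have hg𝔮 : g ∉ 𝔮 := hg𝔔
  obtain ⟨-, hF, hIeq⟩ := face_zero_package (P := P) (φ := φ) (𝔮 := 𝔮) hface hI𝔔
  have hreg𝔮 : IsLogRegularAt P φ 𝔮 := hregV 𝔮 hI𝔔 hg𝔮
  have hreg'𝔮 : ∀ (𝔮' : Ideal A) [𝔮'.IsPrime], 𝔮' ≤ 𝔮 → ideal P φ 𝔮 ≤ 𝔮' → IsLogRegularAt P φ 𝔮' :=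
    fun 𝔮' _ hle hI' => hregV 𝔮' (hIeq ▸ hI') fun h => hg𝔮 (hle h)
  -- transport every `ℤF_𝔭`-phrased hypothesis to `ℤF_𝔮 = ℤF_𝔭`
  have hrank' : n - Module.finrank ℤ (Submodule.span ℤ (faceMonoid P φ 𝔮 : Set (Fin n → ℤ))) ≤ 2 := by
    rw [hF]; exact hrank
  have hQ' : ∀ w, w ∈ Q ↔ ∃ g ∈ Submodule.span ℤ (faceMonoid P φ 𝔮 : Set (Fin n → ℤ)), ∃ m l : ℤ,
      0 ≤ m ∧ 0 ≤ m + (c : ℤ) * l ∧ w = g + m • v + l • x := by rw [hF]; exact hQ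
  have hind' : ∀ g ∈ Submodule.span ℤ (faceMonoid P φ 𝔮 : Set (Fin n → ℤ)), ∀ m l : ℤ,
      g + m • v + l • x = 0 → m = 0 ∧ l = 0 := by rw [hF]; exact hind
  have hspan' : ∀ w : Fin n → ℤ, ∃ g ∈ Submodule.span ℤ (faceMonoid P φ 𝔮 : Set (Fin n → ℤ)),
      ∃ m l : ℤ, w = g + m • v + l • x := by rw [hF]; exact hspan
  have hq' : ∀ q : Q, (q : Fin n → ℤ) ∉ Submodule.span ℤ (faceMonoid P φ 𝔮 : Set (Fin n → ℤ)) →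
      χ (Multiplicative.ofAdd q) ∈ 𝔔 := by rw [hF]; exact hq𝔔
  exact not_isRegularLocalRing_fixedPrime_of_two_le_of_stratum hc hP hsat hreg𝔮 hreg'𝔮 hrank' hPQ hχ hgen hD hK
    hQfg hQ' hind' hspan' rfl hq'

end Summit.ResolutionOfSingularities.ResolutionOfSingularities.Theorems.FRationalResolution.FixedStratumVertexSingularNearby

end
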